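import Summits.AtomisticToContinuum.Crystallization.Theorems.FrustratedLawDichotomyStrainedPatchHomEntrySemanticQuotLeaf
import Summits.AtomisticToContinuum.Crystallization.Theorems.FrustratedLawDichotomyStrainedPatchHomEntrySemanticCells

/-!
# (R2/R6 for the v2 SLAB LEAF) `entryLeafOKHT4A2Q` IN THE QUOTIENT (Σ-) SHAPE, its guarded re-validation, and THE v2 CELLS OF RECORD as `semOKHQ` facts
# (27623 `(H) HomFloor`, hcp half; hand-1 g42; lens-5 NODE 88 «HomEntrySemanticQuot» §5 R2/R6, critic rows 1498 / 1504 / 1510 (1); sequel of `…EntrySemanticQuotLeaf` (v3 leaf) and `…EntrySemanticQuotCells` (v3 cells))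

decomp-a2c hand-1 g42 (crux `AperiodicFrustratedLawGap`, stmt-AtomisticToContinuum-27623).  The landed quotient leaf file `…EntrySemanticQuotLeaf` ports the
v3 slab leaf `entryLeafOKHT4A2QS` (SHARP third-order certificate side `htCertSideA2QS`) to the sign-free Σ-shape and re-validates v3 cells by the guard
`innerGuardQ`.  Four of the ten worst-ray cells of record are v2 cells — certificate side `htCertSideA2Q` (plain second-order near chunk), slab Boolean
`entryLeafOKHT4A2Q`, certified as `entryLeafOKHT4A2QQDCRS muRec qX90c … = entryLeafOKHT4A2Q (entryLeafOKHQDCRS muRec qX90c) …`: `B9S` (0.65 t_b),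
`B08M` (0.80, five-coarse), `B385` (0.85, three-coarse), `B910` (0.90, `2⁻¹⁰`, inner tree `tB910`).  This file is their twin of the v3 port:

* §1 ★★★ `entryLeafOKHT4A2Q_soundQ` — soundness of the UNCHANGED v2 slab Boolean for any inner verdict sound in the Σ-shape, concluding in the Σ-shape.
  The tree's proof of `…EntryLeafHTA2Q.entryLeafOKHT4A2Q_sound` differs from that of `…EntryLeafHTA2QS.entryLeafOKHT4A2QS_sound` in exactly four
  tokens (the Boolean's name, the certificate side's name in the `unfold`, and the near-chunk comparison lemma `refForce_htBU_leA2Q`); accordingly this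
  proof is `…EntrySemanticQuotLeaf.entryLeafOKHT4A2QS_soundQ` VERBATIM with those four tokens — the slab argument never looked at the shuffle signs.
* §2 (R6) `entryLeafOKHT4A2Q_of_guard` / `entryLeafOKHT4A2Q_Q_of_guard` — guarded transfer of an EVALUATED v2 slab certificate to the inner Σ-verdict.
* §3 ★ `semOKHQ_of_A2QQ`, ★ `semOKHQ_of_A2Q_guard` — the v2 production leaf / the re-validated v2 cell as a `semOKHQ μ c w` fact (whole box, no sign).
* §4 the v2 cells of record on boxes not already covered: `B08M`, `B385`, `B910` — guard trees by ONE cheap kernel evaluation each (sign tests on the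
  sheet-tracked hull boxes; `B910` has the multi-leaf inner tree `tB910`), the re-validation one-liners at `muRec`, and the level transports to `μ₇₈` / `μ₇₄`.
  OUTCOME: all guards pass (`B9S` too — same box `cB065 × wB9A` as the v3 cell `B9V`, whose quotient fact `…QuotCells.semQ_B9V` already covers it, so it
  is not restated here).

With `…EntrySemanticQuotCells` this puts ALL the worst-ray boxes of record (`B9 · G70 · G72E · G75S · G77S · G80X · B08M · B385 · B910`; 0.65–0.90 t_b)
into the quotient currency as FULL-box facts at zero fit-test cost — the «listed quotient cell» kind of `…QuotColumn.colLeaf5Q`.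

Kernel facts (guards) + folklore chaining + formal bookkeeping; 0 sorry; standard axioms; no definitions / instances / notation / `#eval`.
`--supports stmt-AtomisticToContinuum-27623`.
-/

noncomputable section

namespace Summit.AtomisticToContinuum.Crystallization.Theorems.FrustratedLawDichotomyStrainedPatchHomEntryLeafHT

open scoped BigOperators RealInnerProductSpace
open Literature.Analysis.ValidatedNumerics.Numerics
open Summit.AtomisticToContinuum.Crystallization.Theorems.ChargedEnergyGapNegative (E3)
open Summit.AtomisticToContinuum.Crystallization.Theorems.FrustratedLawDichotomySchurCut (effPot w₄₅ ω₄)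
open Summit.AtomisticToContinuum.Crystallization.Theorems.FrustratedLawDichotomyAveragingRuleTightFree (TightNearCap BadNearCap)
open Summit.AtomisticToContinuum.Crystallization.Theorems.FrustratedLawDichotomyExemptAbsorption (ExemptNear)
open Summit.AtomisticToContinuum.Crystallization.Theorems.FrustratedLawDichotomyStrainedPatchHomSplit (ExRec latPt hexFrame hcpShift HomFloor)
open Summit.AtomisticToContinuum.Crystallization.Theorems.FrustratedLawDichotomyStrainedPatchTaylorChord (segGd)
open Summit.AtomisticToContinuum.Crystallization.Theorems.FrustratedLawDichotomyStrainedPatchHomCurvCentreKit (cenShuf cenShuf_apply)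
open Summit.AtomisticToContinuum.Crystallization.Theorems.FrustratedLawDichotomyStrainedPatchHomCurvLeaf
open Summit.AtomisticToContinuum.Crystallization.Theorems.FrustratedLawDichotomyStrainedPatchHomCurvLJ (isCenLJ curvCheckLJM naiveLJ ljLabelOK)
open Summit.AtomisticToContinuum.Crystallization.Theorems.FrustratedLawDichotomyStrainedPatchHomForceJacN
open Summit.AtomisticToContinuum.Crystallization.Theorems.FrustratedLawDichotomyStrainedPatchHomSlopeLJ
open Summit.AtomisticToContinuum.Crystallization.Theorems.FrustratedLawDichotomyStrainedPatchHomSlopeLJAffine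
open Summit.AtomisticToContinuum.Crystallization.Theorems.FrustratedLawDichotomyStrainedPatchHomSlopeLJAffine2Kit
open Summit.AtomisticToContinuum.Crystallization.Theorems.FrustratedLawDichotomyStrainedPatchHomSlopeLJAffine2Q
open Summit.AtomisticToContinuum.Crystallization.Theorems.FrustratedLawDichotomyStrainedPatchHomForceHcp (xiBallOK norm_le_quarter_of_xiBallOK)
open Summit.AtomisticToContinuum.Crystallization.Theorems.FrustratedLawDichotomyStrainedPatchHomSlabConfine (abs_apply_le_of_qcert)
open Summit.AtomisticToContinuum.Crystallization.Theorems.FrustratedLawDichotomyStrainedPatchHomSlabLeaf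
open Summit.AtomisticToContinuum.Crystallization.Theorems.FrustratedLawDichotomyStrainedPatchHomEntryTable (muRec)
open Summit.AtomisticToContinuum.Crystallization.Theorems.FrustratedLawDichotomyStrainedPatchHomEntryFitTolerance (cT080 cT085 cT090)
open Summit.AtomisticToContinuum.Crystallization.Theorems.FrustratedLawDichotomyStrainedPatchHomEntryFitHcpCentred
open Summit.AtomisticToContinuum.Crystallization.Theorems.FrustratedLawDichotomyStrainedPatchHomCertTree (CertTree treeOK treeOK_sound)
open Summit.AtomisticToContinuum.Crystallization.Theorems.FrustratedLawDichotomyStrainedPatchHomEntrySemanticQuot (semOKHQ semOKHQ_of_sound semOKHQ_mono_level treeOK_of_guard sectorOut)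
open Summit.AtomisticToContinuum.Crystallization.Theorems.FrustratedLawDichotomyStrainedPatchHomEntryFlipHcp (shufOut)

/-! ## §1. Soundness of the v2 slab leaf `entryLeafOKHT4A2Q` in the Σ-shape -/

/-- ★★★ **SOUNDNESS OF THE (UNCHANGED) v2 SLAB LEAF `entryLeafOKHT4A2Q` IN THE QUOTIENT (Σ-) SHAPE, FOR ANY INNER VERDICT SOUND IN THE Σ-SHAPE.**
The Boolean is the tree's; only the semantic shape of `inner` and of the conclusion's hypotheses changes: the two shuffle SIGNS `0 ≤ ξ₀, 0 ≤ ξ₂` are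
REPLACED by the two SECTOR hypotheses `ξ₁ ≤ 0, ξ₀² ≤ 3ξ₁²`, which the slab argument merely forwards to the inner tree (the true shuffle `η = ξ` is the
inner point).  [folklore chaining: the proof of `…EntryLeafHTA2Q.entryLeafOKHT4A2Q_sound` VERBATIM with the two hypothesis types substituted
(= `…EntrySemanticQuotLeaf.entryLeafOKHT4A2QS_soundQ` with the four v2 tokens)] -/
theorem entryLeafOKHT4A2Q_soundQ {μ : ℤ} {inner : ((Fin 3 × Fin 3) ⊕ Fin 3 → ℤ) → ((Fin 3 × Fin 3) ⊕ Fin 3 → ℤ) → Bool}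
    (hinner : ∀ c w, inner c w = true → ∀ (U : E3 →L[ℝ] E3) (ξ : E3), (∀ v v' : E3, ⟪U v, v'⟫ = ⟪v, U v'⟫) → ‖U - 1‖ ≤ 1 / 4 →
      (∀ ab : Fin 3 × Fin 3, |(U (EuclideanSpace.single ab.2 (1 : ℝ))) ab.1 - (c (Sum.inl ab) : ℝ) / SC| ≤ (w (Sum.inl ab) : ℝ) / SC) →
      (∀ i : Fin 3, |ξ i - (c (Sum.inr i) : ℝ) / SC| ≤ (w (Sum.inr i) : ℝ) / SC) → ξ 1 ≤ 0 → (ξ 0) ^ 2 ≤ 3 * (ξ 1) ^ 2 →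
      (∀ (M : ℕ) (z : Fin M → E3) (cc : Fin M), Function.Injective z →
          Set.range z = {x : E3 | dist x (z cc) ≤ 133 / 10 ∧ ∃ a : Fin 3 → ℤ,
            x = z cc + latPt U hexFrame a ∨ x = z cc + latPt U hexFrame a + U (hcpShift + ξ)} →
          TightNearCap (9 / 5) (3 / 2) z cc ∨ ExemptNear (9 / 5) ExRec z cc ∨ BadNearCap (9 / 5) (3 / 2) z cc) ∨
        (μ : ℝ) / SC ≤ ∑ b ∈ (Fintype.piFinset fun _ : Fin 3 => Finset.Icc (-7 : ℤ) 7).filter (fun b => b ≠ 0), effPot w₄₅ ω₄ (3 / 400) ‖latPt U hexFrame b‖ +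
          ∑ b ∈ (Fintype.piFinset fun _ : Fin 3 => Finset.Icc (-7 : ℤ) 7), effPot w₄₅ ω₄ (3 / 400) ‖latPt U hexFrame b + U (hcpShift + ξ)‖)
    {p : HTCert} {Q : Fin 3 → ℤ} {Gn : ℤ} {J : Fin 3 → Fin 3 × Fin 3 → ℤ} {t : CertTree ((Fin 3 × Fin 3) ⊕ Fin 3)} {c w : (Fin 3 × Fin 3) ⊕ Fin 3 → ℤ}
    (h : entryLeafOKHT4A2Q inner p Q Gn J t c w = true) (U : E3 →L[ℝ] E3) (ξ : E3)
    (hsa : ∀ v v' : E3, ⟪U v, v'⟫ = ⟪v, U v'⟫) (hU : ‖U - 1‖ ≤ 1 / 4)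
    (hbox : ∀ ab : Fin 3 × Fin 3, |(U (EuclideanSpace.single ab.2 (1 : ℝ))) ab.1 - (c (Sum.inl ab) : ℝ) / SC| ≤ (w (Sum.inl ab) : ℝ) / SC)
    (hξ : ∀ i : Fin 3, |ξ i - (c (Sum.inr i) : ℝ) / SC| ≤ (w (Sum.inr i) : ℝ) / SC) (hb : ξ 1 ≤ 0) (hab : (ξ 0) ^ 2 ≤ 3 * (ξ 1) ^ 2) :
    (∀ (M : ℕ) (z : Fin M → E3) (cc : Fin M), Function.Injective z →
        Set.range z = {x : E3 | dist x (z cc) ≤ 133 / 10 ∧ ∃ a : Fin 3 → ℤ,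
          x = z cc + latPt U hexFrame a ∨ x = z cc + latPt U hexFrame a + U (hcpShift + ξ)} →
        TightNearCap (9 / 5) (3 / 2) z cc ∨ ExemptNear (9 / 5) ExRec z cc ∨ BadNearCap (9 / 5) (3 / 2) z cc) ∨
      (μ : ℝ) / SC ≤ ∑ b ∈ (Fintype.piFinset fun _ : Fin 3 => Finset.Icc (-7 : ℤ) 7).filter (fun b => b ≠ 0), effPot w₄₅ ω₄ (3 / 400) ‖latPt U hexFrame b‖ +
        ∑ b ∈ (Fintype.piFinset fun _ : Fin 3 => Finset.Icc (-7 : ℤ) 7), effPot w₄₅ ω₄ (3 / 400) ‖latPt U hexFrame b + U (hcpShift + ξ)‖ := by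
  classical
  have hS : (0 : ℝ) < SC := by norm_num [SC]
  unfold entryLeafOKHT4A2Q htCertSideA2Q at h
  simp only [Bool.and_eq_true, decide_eq_true_eq] at h
  obtain ⟨⟨⟨⟨⟨⟨⟨⟨⟨hball, hjac⟩, hROK⟩, hcert⟩, hcurvM⟩, hfar1⟩, hfar2⟩, ⟨⟨hs1, hs2⟩, hs3⟩⟩, hGs⟩, htree⟩ := h
  obtain ⟨hKlt, hT, hγ, hr, hconf⟩ := htCertOKU_spec hcert
  -- the reference shuffle: the AFFINE (sheet-tracking) reference at `U`
  set ξ₀ : E3 := affShuf J c U with hξ₀def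
  have hw0 : ∀ i : Fin 3, (0 : ℝ) ≤ (w (Sum.inr i) : ℝ) / SC := fun i => (abs_nonneg _).trans (hξ i)
  have hξ₀box : ∀ i : Fin 3, |ξ₀ i - (c (Sum.inr i) : ℝ) / SC| ≤ (w (Sum.inr i) : ℝ) / SC := by
    intro i
    refine (abs_affShuf_sub_le (J := J) (w := w) U hbox i).trans ?_
    rw [div_le_div_iff_of_pos_right hS]
    exact_mod_cast jacOK_spec hjac i
  have hn : ‖ξ‖ ≤ 1 / 4 := norm_le_quarter_of_xiBallOK hball hξ
  have hn₀ : ‖ξ₀‖ ≤ 1 / 4 := norm_le_quarter_of_xiBallOK hball hξ₀box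
  -- label finsets
  set B : Finset (Fin 3 → ℤ) := (htBU c w).toFinset with hBdef
  set R : Finset (Fin 3 → ℤ) := (htRU c w).toFinset with hRdef
  have hB : B ⊆ Fintype.piFinset fun _ : Fin 3 => Finset.Icc (-11 : ℤ) 11 := by
    intro b hb
    rw [← boxLabels11_toFinset]
    exact List.mem_toFinset.2 (mem_boxLabels11_of_mem_htUniv (mem_htUniv_of_mem_htBU (List.mem_toFinset.1 hb)))
  have hBin : ∀ bb ∈ B, ‖latPt U hexFrame bb + U (hcpShift + ξ)‖ ≤ 7 :=
    fun bb hbb => norm_le_seven_of_htIn U hbox ξ hξ (htIn_of_mem_htBU (List.mem_toFinset.1 hbb))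
  have hR : ∀ bb ∈ (Fintype.piFinset fun _ : Fin 3 => Finset.Icc (-11 : ℤ) 11) \ B, ‖latPt U hexFrame bb + U (hcpShift + ξ)‖ ≤ 7 →
      bb ∈ R ∧ 6 ≤ ‖latPt U hexFrame bb + U (hcpShift + ξ)‖ := by
    intro bb hbb h7
    obtain ⟨hbox11, hnotB⟩ := Finset.mem_sdiff.1 hbb
    rw [← boxLabels11_toFinset] at hbox11
    have hbL : bb ∈ boxLabels11 := List.mem_toFinset.1 hbox11
    have hlo := lo_le_of_norm_le_seven U hbox ξ hξ h7
    by_cases huniv : bb ∈ htUniv c w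
    swap
    · exact absurd h7 (not_le.2 (seven_lt_norm_of_not_mem_htUniv U hbox hξ hKlt hbL huniv))
    by_cases hin : htIn c w bb = true
    · exact absurd (List.mem_toFinset.2 (mem_htBU_of_htIn huniv hin)) hnotB
    · have hmemR : bb ∈ htRU c w := by
        refine List.mem_filter.2 ⟨huniv, ?_⟩
        simp only [Bool.and_eq_true, Bool.not_eq_true', decide_eq_true_eq]
        exact ⟨by simpa using hin, hlo⟩
      have h36 : 36 * (SC : ℤ) ≤ (fjQ c w bb).lo := by
        have := List.all_eq_true.1 hROK bb hmemR
        simpa using this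
      exact ⟨List.mem_toFinset.2 hmemR, six_le_norm_of_lo U hbox ξ hξ h36⟩
  -- the Q-floor along the segment
  have hcurv : ∀ s ∈ Set.Ioo (0 : ℝ) 1,
      ((p.lam₁ + p.lam₂ + p.lam₃ : ℤ) : ℝ) / SC * ‖U (ξ - ξ₀)‖ ^ 2 + ∑ i : Fin 3, ∑ j : Fin 3, (p.D i j : ℝ) / SC * ((U (ξ - ξ₀)) i * (U (ξ - ξ₀)) j) ≤
        ∑ bb ∈ B, segGd (fun x : ℝ => x⁻¹ ^ 7 - x⁻¹ ^ 13) (latPt U hexFrame bb + U (hcpShift + ξ₀)) (U (ξ - ξ₀)) s :=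
    fun s hs => jac_floorM_of_three_checks (htBU_nodup c w) hcurvM hfar1 hfar2 U hU hbox ξ₀ ξ hξ₀box hξ hn₀ hn hs
  -- the reference force bound ALONG THE AFFINE REFERENCE, chunked
  have hf₀ : |∑ bb ∈ B, (‖latPt U hexFrame bb + U (hcpShift + ξ₀)‖⁻¹ ^ 8 - ‖latPt U hexFrame bb + U (hcpShift + ξ₀)‖⁻¹ ^ 14) *
      ⟪latPt U hexFrame bb + U (hcpShift + ξ₀), U (ξ - ξ₀)⟫| ≤ (p.Gs : ℝ) / SC * ‖U (ξ - ξ₀)‖ := by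
    have key := refForce_htBU_leA2Q hs1 hs2 hs3 U hU hbox hn₀ ξ
    refine key.trans (mul_le_mul_of_nonneg_right ?_ (norm_nonneg _))
    rw [div_le_div_iff_of_pos_right hS]
    exact_mod_cast hGs
  -- slab ⟹ confinement ⟹ the inner verdict on the sheet-tracked confined box
  have hslab : ((p.lam₁ + p.lam₂ + p.lam₃ : ℤ) : ℝ) / SC * ‖U (ξ - ξ₀)‖ ^ 2 +
        ∑ i : Fin 3, ∑ j : Fin 3, (p.D i j : ℝ) / SC * ((U (ξ - ξ₀)) i * (U (ξ - ξ₀)) j) ≤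
      ((6000 / 343 * (7 : ℝ)⁻¹ ^ 4 + 2880 / 49 * (7 : ℝ)⁻¹ ^ 5 + 10 / 7 * (7 : ℝ)⁻¹ ^ 6 + 2 * (7 : ℝ)⁻¹ ^ 7) + (p.Gs : ℝ) / SC +
        R.card * (6 : ℝ)⁻¹ ^ 7) * ‖U (ξ - ξ₀)‖ →
      (∀ (M : ℕ) (z : Fin M → E3) (cc : Fin M), Function.Injective z →
          Set.range z = {x : E3 | dist x (z cc) ≤ 133 / 10 ∧ ∃ a : Fin 3 → ℤ,
            x = z cc + latPt U hexFrame a ∨ x = z cc + latPt U hexFrame a + U (hcpShift + ξ)} →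
          TightNearCap (9 / 5) (3 / 2) z cc ∨ ExemptNear (9 / 5) ExRec z cc ∨ BadNearCap (9 / 5) (3 / 2) z cc) ∨
        (μ : ℝ) / SC ≤ ∑ b ∈ (Fintype.piFinset fun _ : Fin 3 => Finset.Icc (-7 : ℤ) 7).filter (fun b => b ≠ 0), effPot w₄₅ ω₄ (3 / 400) ‖latPt U hexFrame b‖ +
          ∑ b ∈ (Fintype.piFinset fun _ : Fin 3 => Finset.Icc (-7 : ℤ) 7), effPot w₄₅ ω₄ (3 / 400) ‖latPt U hexFrame b + U (hcpShift + ξ)‖ := by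
    intro hq
    have ht0 : (0 : ℝ) < (htTU p c w : ℝ) / SC := div_pos (by exact_mod_cast hT) hS
    have hle := slabConst_le_htTU p c w
    have hQ : (p.lamT : ℝ) / SC * ‖U (ξ - ξ₀)‖ ^ 2 + ∑ i : Fin 3, ∑ j : Fin 3, (p.D i j : ℝ) / SC * ((U (ξ - ξ₀)) i * (U (ξ - ξ₀)) j) ≤
        (htTU p c w : ℝ) / SC * ‖U (ξ - ξ₀)‖ := by
      have e : (p.lamT : ℝ) = ((p.lam₁ + p.lam₂ + p.lam₃ : ℤ) : ℝ) := by simp [HTCert.lamT]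
      rw [e]
      exact hq.trans (mul_le_mul_of_nonneg_right hle (norm_nonneg _))
    have hΔk : ∀ k : Fin 3, |(U (ξ - ξ₀)) k| ≤ (p.rS k : ℝ) / SC := fun k =>
      abs_apply_le_of_qcert (Q := fun x : E3 => (p.lamT : ℝ) / SC * ‖x‖ ^ 2 + ∑ i : Fin 3, ∑ j : Fin 3, (p.D i j : ℝ) / SC * (x i * x j))
        ht0 (div_pos (by exact_mod_cast hγ k) hS) (div_nonneg (by exact_mod_cast hr k) hS.le) k (fun x => htConfU_sound (hconf k) x) hQ
    have hy := fun k => abs_coord_le_of_confined hU (ξ - ξ₀) (r := fun j => (p.rS j : ℝ) / SC) (κ := fun k => (htκ c w k : ℝ) / SC) hΔk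
      (rowDev_le U hbox) k
    -- the sheet-tracked confined box: `ζ = ξ − ξ₀(U)` recentred at `ξ_c`
    have hζ : ∀ i : Fin 3, |((c (Sum.inr i) : ℝ) / SC + (ξ - ξ₀) i) - (c (Sum.inr i) : ℝ) / SC| ≤ (htW p c w (Sum.inr i) : ℝ) / SC := by
      intro i
      rw [add_sub_cancel_left]
      refine (hy i).trans ?_
      rw [htW_inr]
      have hρ := sqrt_le_htρ p
      have hκ0 : (0 : ℝ) ≤ (htκ c w i : ℝ) / SC :=
        (Finset.sum_nonneg fun j _ => abs_nonneg _).trans (rowDev_le U hbox i)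
      have hcd := div_le_cdiv (a := htκ c w i * 4 * htρ p) (b := 3 * (SC : ℤ)) (by norm_num [SC])
      have step : (htκ c w i : ℝ) / SC * (4 / 3 * Real.sqrt (∑ j : Fin 3, ((p.rS j : ℝ) / SC) ^ 2)) ≤
          ((cdiv (htκ c w i * 4 * htρ p) (3 * SC) : ℤ) : ℝ) / SC := by
        have h1 : (htκ c w i : ℝ) / SC * (4 / 3 * Real.sqrt (∑ j : Fin 3, ((p.rS j : ℝ) / SC) ^ 2)) ≤
            (htκ c w i : ℝ) / SC * (4 / 3 * ((htρ p : ℝ) / SC)) := by gcongr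
        refine h1.trans ?_
        rw [le_div_iff₀ hS]
        have e : (htκ c w i : ℝ) / SC * (4 / 3 * ((htρ p : ℝ) / SC)) * SC = ((htκ c w i * 4 * htρ p : ℤ) : ℝ) / ((3 * (SC : ℤ) : ℤ) : ℝ) := by
          push_cast; field_simp
        rw [e]; exact hcd
      push_cast
      rw [add_div]
      linarith
    -- the tree point `(U_ab, ξ_c,i + ζ_i)` lies in the rounded confined box; run the inner certificate tree there
    have hx : ∀ k, |(Sum.elim (fun ab : Fin 3 × Fin 3 => (U (EuclideanSpace.single ab.2 (1 : ℝ))) ab.1)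
        (fun i : Fin 3 => (c (Sum.inr i) : ℝ) / SC + (ξ - ξ₀) i) k) - (c k : ℝ) / SC| ≤ (htWr p c w k : ℝ) / SC := by
      intro k
      rcases k with ab | i
      · exact hbox ab
      · refine (hζ i).trans ?_
        rw [div_le_div_iff_of_pos_right hS]
        exact_mod_cast htW_le_htWr p c w i
    have key := treeOK_sound SC_pos
      (P := fun x : (Fin 3 × Fin 3) ⊕ Fin 3 → ℝ => ∀ (V : E3 →L[ℝ] E3) (η : E3), (∀ v v' : E3, ⟪V v, v'⟫ = ⟪v, V v'⟫) → ‖V - 1‖ ≤ 1 / 4 →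
        (∀ ab : Fin 3 × Fin 3, (V (EuclideanSpace.single ab.2 (1 : ℝ))) ab.1 = x (Sum.inl ab)) →
        (∀ i : Fin 3, η i = x (Sum.inr i) + (affShuf J c V - cenShuf c) i) → η 1 ≤ 0 → (η 0) ^ 2 ≤ 3 * (η 1) ^ 2 →
        (∀ (M : ℕ) (z : Fin M → E3) (cc : Fin M), Function.Injective z →
            Set.range z = {x : E3 | dist x (z cc) ≤ 133 / 10 ∧ ∃ a : Fin 3 → ℤ,
              x = z cc + latPt V hexFrame a ∨ x = z cc + latPt V hexFrame a + V (hcpShift + η)} →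
            TightNearCap (9 / 5) (3 / 2) z cc ∨ ExemptNear (9 / 5) ExRec z cc ∨ BadNearCap (9 / 5) (3 / 2) z cc) ∨
          (μ : ℝ) / SC ≤ ∑ b ∈ (Fintype.piFinset fun _ : Fin 3 => Finset.Icc (-7 : ℤ) 7).filter (fun b => b ≠ 0), effPot w₄₅ ω₄ (3 / 400) ‖latPt V hexFrame b‖ +
            ∑ b ∈ (Fintype.piFinset fun _ : Fin 3 => Finset.Icc (-7 : ℤ) 7), effPot w₄₅ ω₄ (3 / 400) ‖latPt V hexFrame b + V (hcpShift + η)‖)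
      (hullInner inner J c) (fun c' w' hv x hx' V η hVsa hV1 hVx hηx hb' hab' => by
        have hVb : ∀ ab : Fin 3 × Fin 3, |(V (EuclideanSpace.single ab.2 (1 : ℝ))) ab.1 - (c' (Sum.inl ab) : ℝ) / SC| ≤ (w' (Sum.inl ab) : ℝ) / SC :=
          fun ab => by rw [hVx ab]; exact hx' (Sum.inl ab)
        refine hinner (hullC J c c') (hullWd J w') hv V η hVsa hV1 (fun ab => hVb ab) (fun i => ?_) hb' hab'
        rw [hηx i]
        exact hull_point V hVb (hx' (Sum.inr i)))
      t c (htWr p c w) htree _ hx U ξ hsa hU (fun _ => rfl) (fun i => by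
        show ξ i = (c (Sum.inr i) : ℝ) / SC + (ξ - ξ₀) i + (affShuf J c U - cenShuf c) i
        rw [PiLp.sub_apply, PiLp.sub_apply, cenShuf_apply, hξ₀def]; ring) hb hab
    exact key
  exact hver_of_slabParts hU hn₀ hn B R hB hBin hR hcurv hf₀ hslab

/-! ## §2. Guarded re-validation of an evaluated v2 slab certificate (R6) -/

/-- ★ (R6) An EVALUATED v2 slab certificate over `inner₁`, plus the guard tree over `g` on the same sheet-tracked hull boxes, is a v2 slab certificate over
any `inner₂` with `inner₁ ∧ g ⇒ inner₂` box-wise — the certificate side is untouched, the inner tree is transferred by `treeOK_of_guard`. [formal bookkeeping] -/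
theorem entryLeafOKHT4A2Q_of_guard {inner₁ g inner₂ : ((Fin 3 × Fin 3) ⊕ Fin 3 → ℤ) → ((Fin 3 × Fin 3) ⊕ Fin 3 → ℤ) → Bool}
    (himp : ∀ c w, inner₁ c w = true → g c w = true → inner₂ c w = true)
    {p : HTCert} {Q : Fin 3 → ℤ} {Gn : ℤ} {J : Fin 3 → Fin 3 × Fin 3 → ℤ} {t : CertTree ((Fin 3 × Fin 3) ⊕ Fin 3)} {c w : (Fin 3 × Fin 3) ⊕ Fin 3 → ℤ}
    (h : entryLeafOKHT4A2Q inner₁ p Q Gn J t c w = true) (hg : treeOK (hullInner g J c) t c (htWr p c w) = true) :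
    entryLeafOKHT4A2Q inner₂ p Q Gn J t c w = true := by
  unfold entryLeafOKHT4A2Q at h ⊢
  simp only [Bool.and_eq_true] at h ⊢
  exact ⟨h.1, treeOK_of_guard (v₁ := hullInner inner₁ J c) (g := hullInner g J c) (v₂ := hullInner inner₂ J c)
    (fun _ _ h1 h2 => himp _ _ h1 h2) t c (htWr p c w) h.2 hg⟩

/-- (R6, the implication specialised) old inner verdict of record ⇒ inner Σ-verdict under the guard `innerGuardQ`, v2 slab leaf. [formal bookkeeping] -/
theorem entryLeafOKHT4A2Q_Q_of_guard {μ : ℤ} {q : Fin 4 → ℤ} {p : HTCert} {Q : Fin 3 → ℤ} {Gn : ℤ} {J : Fin 3 → Fin 3 × Fin 3 → ℤ}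
    {t : CertTree ((Fin 3 × Fin 3) ⊕ Fin 3)} {c w : (Fin 3 × Fin 3) ⊕ Fin 3 → ℤ} (h : entryLeafOKHT4A2Q (entryLeafOKHQDCRS μ q) p Q Gn J t c w = true)
    (hg : treeOK (hullInner innerGuardQ J c) t c (htWr p c w) = true) :
    entryLeafOKHT4A2Q (entryLeafOKHQDCRSQ μ q) p Q Gn J t c w = true :=
  entryLeafOKHT4A2Q_of_guard (fun c' w' h1 h2 => entryLeafOKHQDCRSQ_of_guard μ q c' w' h1 h2) h hg

/-! ## §3. The v2 semantic facts in the quotient currency -/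

/-- ★ **A SHEET CELL CERTIFIED WITH EXPLICIT PAYLOADS by the v2 slab leaf over the inner Σ-verdict is a `semOKHQ` fact at level `μ`.** [formal bookkeeping] -/
theorem semOKHQ_of_A2QQ {μ : ℤ} {q : Fin 4 → ℤ} {p : HTCert} {Q : Fin 3 → ℤ} {Gn : ℤ} {J : Fin 3 → Fin 3 × Fin 3 → ℤ}
    {t : CertTree ((Fin 3 × Fin 3) ⊕ Fin 3)} {c w : (Fin 3 × Fin 3) ⊕ Fin 3 → ℤ} (h : entryLeafOKHT4A2Q (entryLeafOKHQDCRSQ μ q) p Q Gn J t c w = true) :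
    semOKHQ μ c w = true :=
  semOKHQ_of_sound (entryLeafOKHT4A2Q (entryLeafOKHQDCRSQ μ q) p Q Gn J t)
    (fun _ _ hv U ξ hsa _ hU _ hbox hξ hb hab =>
      entryLeafOKHT4A2Q_soundQ (fun c₁ w₁ h₁ V η hVsa hV1 hVb hη hb₁ hab₁ => entryLeafOKHQDCRSQ_sound c₁ w₁ h₁ V η hVsa hV1 hVb hη hb₁ hab₁)
        hv U ξ hsa hU hbox hξ hb hab) h

/-- ★ (R6) **AN OLD v2 CELL, RE-VALIDATED**: a cell certified by the v2 slab leaf over the inner verdict OF RECORD (`entryLeafOKHT4A2QQDCRS μ q …` unfolded),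
plus its (cheap) guard tree, is a `semOKHQ` fact — on the WHOLE box, both `ξ₂` halves, no sign. [formal bookkeeping] -/
theorem semOKHQ_of_A2Q_guard {μ : ℤ} {q : Fin 4 → ℤ} {p : HTCert} {Q : Fin 3 → ℤ} {Gn : ℤ} {J : Fin 3 → Fin 3 × Fin 3 → ℤ}
    {t : CertTree ((Fin 3 × Fin 3) ⊕ Fin 3)} {c w : (Fin 3 × Fin 3) ⊕ Fin 3 → ℤ} (h : entryLeafOKHT4A2Q (entryLeafOKHQDCRS μ q) p Q Gn J t c w = true)
    (hg : treeOK (hullInner innerGuardQ J c) t c (htWr p c w) = true) : semOKHQ μ c w = true :=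
  semOKHQ_of_A2QQ (entryLeafOKHT4A2Q_Q_of_guard h hg)

/-- The v2 cell Boolean of record `entryLeafOKHT4A2QQDCRS` IS the v2 slab leaf over the inner verdict of record. [formal bookkeeping: `rfl`] -/
theorem entryLeafOKHT4A2QQDCRS_eq (μ : ℤ) (q : Fin 4 → ℤ) (p : HTCert) (Q : Fin 3 → ℤ) (Gn : ℤ) (J : Fin 3 → Fin 3 × Fin 3 → ℤ)
    (t : CertTree ((Fin 3 × Fin 3) ⊕ Fin 3)) (c w : (Fin 3 × Fin 3) ⊕ Fin 3 → ℤ) :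
    entryLeafOKHT4A2QQDCRS μ q p Q Gn J t c w = entryLeafOKHT4A2Q (entryLeafOKHQDCRS μ q) p Q Gn J t c w := rfl

/-! ## §4. The v2 cells of record `B08M`, `B385`, `B910`, re-validated (kernel guards + one-liners + levels of record) -/

/-- ★ KERNEL (guard): the shuffle-sign prune fires on no inner hull box of the `B08M` cell (0.80 t_b, five-coarse, v2, one inner leaf). -/
theorem guardQ_B08M : treeOK (hullInner innerGuardQ JB08 cT080) CertTree.leaf cT080 (htWr pB08M2 cT080 wB08M) = true := by
  decide +kernel

/-- ★ KERNEL (guard): the shuffle-sign prune fires on no inner hull box of the `B385` cell (0.85 t_b, three-coarse, v2, one inner leaf). -/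
theorem guardQ_B385 : treeOK (hullInner innerGuardQ JT085 cT085) CertTree.leaf cT085 (htWr pB385A2 cT085 wB385) = true := by
  decide +kernel

/-- ★ KERNEL (guard): the shuffle-sign prune fires on none of the inner hull boxes of the `B910` cell (0.90 t_b, `2⁻¹⁰`, v2, inner tree `tB910`). -/
theorem guardQ_B910 : treeOK (hullInner innerGuardQ JT090 cT090) tB910 cT090 (htWr pB910A2 cT090 wB910) = true := by
  decide +kernel

/-- ★★ `B08M` (0.80 t_b, v2) is a `semOKHQ muRec` fact on its whole box. [formal bookkeeping: `semOKHQ_of_A2Q_guard`] -/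
theorem semQ_B08M : semOKHQ muRec cT080 wB08M = true := semOKHQ_of_A2Q_guard entryLeafOKHT4A2QQDCRS_B08M2 guardQ_B08M

/-- ★★ `B385` (0.85 t_b, v2) is a `semOKHQ muRec` fact on its whole box. [formal bookkeeping] -/
theorem semQ_B385 : semOKHQ muRec cT085 wB385 = true := semOKHQ_of_A2Q_guard entryLeafOKHT4A2QQDCRS_B385A2 guardQ_B385

/-- ★★ `B910` (0.90 t_b, v2, inner tree `tB910`) is a `semOKHQ muRec` fact on its whole box. [formal bookkeeping] -/
theorem semQ_B910 : semOKHQ muRec cT090 wB910 = true := semOKHQ_of_A2Q_guard entryLeafOKHT4A2QQDCRS_B910A2 guardQ_B910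

/-- `B08M` at `μ₇₈`. [formal bookkeeping: `semOKHQ_mono_level`] -/
theorem semQ78_B08M : semOKHQ (-399232847967326) cT080 wB08M = true := semOKHQ_mono_level level78_le_muRec semQ_B08M
/-- `B385` at `μ₇₈`. [formal bookkeeping] -/
theorem semQ78_B385 : semOKHQ (-399232847967326) cT085 wB385 = true := semOKHQ_mono_level level78_le_muRec semQ_B385
/-- `B910` at `μ₇₈`. [formal bookkeeping] -/
theorem semQ78_B910 : semOKHQ (-399232847967326) cT090 wB910 = true := semOKHQ_mono_level level78_le_muRec semQ_B910

/-- `B08M` at `μ₇₄`. [formal bookkeeping] -/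
theorem semQ74_B08M : semOKHQ (-399210329969189) cT080 wB08M = true := semOKHQ_mono_level level74_le_muRec semQ_B08M
/-- `B385` at `μ₇₄`. [formal bookkeeping] -/
theorem semQ74_B385 : semOKHQ (-399210329969189) cT085 wB385 = true := semOKHQ_mono_level level74_le_muRec semQ_B385
/-- `B910` at `μ₇₄`. [formal bookkeeping] -/
theorem semQ74_B910 : semOKHQ (-399210329969189) cT090 wB910 = true := semOKHQ_mono_level level74_le_muRec semQ_B910

end Summit.AtomisticToContinuum.Crystallization.Theorems.FrustratedLawDichotomyStrainedPatchHomEntryLeafHT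

end
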